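import Summits.Parity.BatemanHorn.Theorems.AlmostPrimeZerosSystemMomentDeficitMassCountCore
import Summits.Parity.BatemanHorn.Theorems.AlmostPrimeZerosSystemMomentDeficitLocalisation

/-!
# Crux `SystemMomentDeficit` (stmt-Parity-11326): the mass/count split — the rough mass theorem

Route `AlmostPrimeZeros`, crux `Summit.Parity.BatemanHorn.Theses.AlmostPrimeZeros.SystemMomentDeficit`
(rank 4): `m₁(x) − v(x) ≤ C_f` for the capped statistic of every Bateman–Horn system.  By the two-sided
localisation (`Localisation.systemMomentDeficit_iff_covLowerBound`, lead c4) the crux is EQUIVALENT to: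
for every system, `Cov_x(A, B) ≥ −C` for all `x ≥ 2`, where `A(n) = Σᵢ #{q ∈ PP(⌊√x⌋) : q ∣ fᵢ(n)⁺ ≠ 0}`
is the small COUNT and `B = s_f − A` the capped COUNT of the prime(-square) factors beyond `√x` — the
anatomy statement (U), open for every system with a member of degree `≥ 2`.

This file proves the MASS companion UNCONDITIONALLY and two-sidedly (`abs_cov_smallCount_roughMass_le`):
for every Bateman–Horn system, `|Cov_x(A, M)| ≤ C_f` for all `x ≥ 2`, where
`M(n) = (Σᵢ Σ_{d ∣ fᵢ(n)⁺, d ∉ PP(⌊√x⌋)} Λ(d)) / log x` is the rough von Mangoldt mass of the values —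
the log-mass (in units of `log x`) of their prime-power divisors outside `PP(√x)`, i.e. of every prime
`p > √x` with full multiplicity (each carrying `log p/log x > 1/2`, so `M` dominates half the count of the
primes `> √x` inside `B`) plus the excess powers of the primes `≤ √x`.  Mechanism: Chebyshev–Hooley
(`Σ_{d ∣ N} Λ(d) = log N`, `roughMass_eq`) makes `M = Σᵢ log fᵢ(n)⁺/log x − R` with `R` the small mass, a
level-`√x` object; `Cov(A, R) = O(1)` is `MassCount.abs_cov_smallCount_smallMass_le_core` (CRT below the
hyperbola, resultants, `Σ_{PP} Λ(q)/q ≤ log x + 2`) and `Cov(A, Σᵢ log fᵢ(n)⁺/log x) = O(1)` is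
`abs_cov_smallCount_logSize_le` (`A = O(log x)` pointwise, `E|log fᵢ(n)⁺ − dᵢ log x| = O(1)`).
Consequence for the crux (dossier `Cruxes/SystemMomentDeficit/NOTES.md`, lead c5): with the MASS of the
large prime factors in place of their COUNT the statement is a theorem, so all the open content of
`SystemMomentDeficit` for `Σ deg ≥ 2` is the conversion mass → count beyond `√x`, i.e. the law of the
SIZES of the large prime factors jointly with the small primes of the values.

Notation (docstrings only).  `Y = x + 1`, `E g = Y⁻¹ Σ_{0 ≤ n ≤ x} g(n)`, `Cov(g, h) = E(gh) − E g · E h`,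
`PP(z)` = primes `≤ z` ∪ prime squares `≤ z`, `Λ` = von Mangoldt.  Everything is [folklore].
-/

namespace Summit.Parity.BatemanHorn.Cruxes.SystemMomentDeficit.MassCount

open scoped BigOperators
open Finset Polynomial
open Literature.NumberTheory.Sieve
open Summit.Parity.BatemanHorn.Theorems.AlmostPrimeZeros.SystemMertens
open Summit.Parity.BatemanHorn.Cruxes.SystemMomentDeficit.Ideator3Sketch
open Summit.Parity.BatemanHorn.Cruxes.SystemMomentDeficit.Localisation

/-! ### Size terms: the covariance of the small count with `Σᵢ log fᵢ(n)⁺ / log x` is `O(1)` -/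

set_option maxHeartbeats 800000 in -- one long bookkeeping proof (≈ 2× the default budget)
/-- **Size terms.**  For a Bateman–Horn system `f` there is `C` such that for every `x ≥ 4`, with
`A(n) = Σᵢ #{q ∈ PP(⌊√x⌋) : q ∣ fᵢ(n)⁺ ≠ 0}` and `G(n) = (Σᵢ log fᵢ(n)⁺) / log x`:
`|Cov_x(A, G)| ≤ C` — `A = O(log x)` pointwise (`smallCount_le_log`) while
`E|G − Σᵢ dᵢ| = O(1/log x)` (`|log fᵢ(n)⁺ − dᵢ log x| ≤ dᵢ log(x/n) + O(1)` beyond `n₀`, two-sided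
polynomial growth, and `Σ_{n ≤ x} log(x/n) ≤ 2x`). [folklore] -/
theorem abs_cov_smallCount_logSize_le :
    ∀ (k : ℕ) (f : Fin k → ℤ[X]), IsBatemanHornSystem f →
    ∃ C : ℝ, ∀ x : ℕ, 4 ≤ x →
      |(∑ n ∈ Finset.range (x + 1),
          ((∑ i, #((Nat.primesLE (Nat.sqrt x) ∪ ((Nat.primesLE (Nat.sqrt x)).filter (fun p => p ^ 2 ≤ Nat.sqrt x)).image (fun p => p ^ 2)).filter (fun q => q ∣ ((f i).eval (n : ℤ)).toNat ∧ ((f i).eval (n : ℤ)).toNat ≠ 0)) : ℕ) : ℝ) *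
            ((∑ i, Real.log (((f i).eval (n : ℤ)).toNat : ℝ)) / Real.log x)) / ((x : ℝ) + 1) -
        (∑ n ∈ Finset.range (x + 1),
          ((∑ i, #((Nat.primesLE (Nat.sqrt x) ∪ ((Nat.primesLE (Nat.sqrt x)).filter (fun p => p ^ 2 ≤ Nat.sqrt x)).image (fun p => p ^ 2)).filter (fun q => q ∣ ((f i).eval (n : ℤ)).toNat ∧ ((f i).eval (n : ℤ)).toNat ≠ 0)) : ℕ) : ℝ)) / ((x : ℝ) + 1) *
          ((∑ n ∈ Finset.range (x + 1),
            (∑ i, Real.log (((f i).eval (n : ℤ)).toNat : ℝ)) / Real.log x) / ((x : ℝ) + 1))| ≤ C := by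
  intro k f hf
  classical
  /- ### constants -/
  choose n0 hn0 using fun i => exists_forall_pow_le_two_mul_eval (f i) (hf.natDegree_pos i) (hf.leadingCoeff_pos i)
  set n₁ : ℕ := (univ : Finset (Fin k)).sup n0 + 1 with hn₁
  have hn₁i : ∀ i, ∀ n : ℕ, n₁ ≤ n → n0 i ≤ n := fun i n hn =>
    le_trans (le_trans (Finset.le_sup (f := n0) (mem_univ i)) (Nat.le_succ _)) hn
  set d : Fin k → ℝ := fun i => ((f i).natDegree : ℝ) with hd
  set Hl : Fin k → ℝ := fun i => Real.log (((∑ j ∈ range ((f i).natDegree + 1), ((f i).coeff j).natAbs : ℕ) : ℝ) + 1) with hHl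
  set B : Fin k → ℝ := fun i => Hl i + d i + 1 with hB
  set cG : ℝ := ∑ i, d i with hcG
  -- `E|G - cG| ≤ CG / log x` with
  set CG : ℝ := ∑ i, (2 * d i + B i + 2 * d i * n₁) with hCG
  -- `A ≤ α + β log x` pointwise with
  set α : ℝ := ∑ i, 2 / Real.log 2 * (Hl i + d i) with hα
  set β : ℝ := ∑ i, 2 / Real.log 2 * d i with hβ
  have hlog2 : (0 : ℝ) < Real.log 2 := Real.log_pos one_lt_two
  have hd0 : ∀ i, 0 ≤ d i := fun i => by positivity
  have hHl0 : ∀ i, 0 ≤ Hl i := fun i => Real.log_nonneg (by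
    have := Nat.cast_nonneg (α := ℝ) (∑ j ∈ range ((f i).natDegree + 1), ((f i).coeff j).natAbs); linarith)
  have hB0 : ∀ i, 0 ≤ B i := fun i => by simp only [hB]; linarith [hHl0 i, hd0 i]
  have h2log : 0 ≤ 2 / Real.log 2 := by positivity
  have hα0 : 0 ≤ α := sum_nonneg fun i _ => mul_nonneg h2log (add_nonneg (hHl0 i) (hd0 i))
  have hβ0 : 0 ≤ β := sum_nonneg fun i _ => mul_nonneg h2log (hd0 i)
  have hCG0 : 0 ≤ CG := sum_nonneg fun i _ => by
    have h1 := hd0 i; have h2 := hB0 i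
    have h3 : (0 : ℝ) ≤ d i * n₁ := mul_nonneg h1 (Nat.cast_nonneg _)
    linarith
  refine ⟨2 * (α + β) * CG, fun x hx => ?_⟩
  /- ### parameters at `x` -/
  set z : ℕ := Nat.sqrt x with hz
  have hx1 : 1 ≤ x := by omega
  have hY0 : (0 : ℝ) < (x : ℝ) + 1 := by positivity
  have hxR : (4 : ℝ) ≤ x := by exact_mod_cast hx
  have hlogx1 : (1 : ℝ) ≤ Real.log x := by
    have hlog4 : (1 : ℝ) ≤ Real.log 4 := by
      rw [Real.le_log_iff_exp_le (by norm_num)]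
      have := Real.exp_one_lt_d9
      linarith
    exact hlog4.trans (Real.log_le_log (by norm_num) hxR)
  have hlogx0 : (0 : ℝ) < Real.log x := by linarith
  have hlogxX : Real.log x ≤ (x : ℝ) + 1 := by
    have := Real.log_le_sub_one_of_pos (show (0 : ℝ) < x by linarith)
    linarith
  /- ### the functions -/
  obtain ⟨a, ha⟩ : ∃ a : ℕ → ℝ, a = fun n : ℕ => ((∑ i, #((Nat.primesLE z ∪ ((Nat.primesLE z).filter (fun p => p ^ 2 ≤ z)).image (fun p => p ^ 2)).filter
      (fun q => q ∣ ((f i).eval (n : ℤ)).toNat ∧ ((f i).eval (n : ℤ)).toNat ≠ 0)) : ℕ) : ℝ) := ⟨_, rfl⟩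
  obtain ⟨g, hg⟩ : ∃ g : ℕ → ℝ, g = fun n : ℕ => (∑ i, Real.log (((f i).eval (n : ℤ)).toNat : ℝ)) / Real.log x := ⟨_, rfl⟩
  have haf : ∀ n : ℕ, ((∑ i, #((Nat.primesLE z ∪ ((Nat.primesLE z).filter (fun p => p ^ 2 ≤ z)).image (fun p => p ^ 2)).filter
      (fun q => q ∣ ((f i).eval (n : ℤ)).toNat ∧ ((f i).eval (n : ℤ)).toNat ≠ 0)) : ℕ) : ℝ) = a n := fun n => by rw [ha]
  have hgf : ∀ n : ℕ, (∑ i, Real.log (((f i).eval (n : ℤ)).toNat : ℝ)) / Real.log x = g n := fun n => by rw [hg]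
  have hc1 : (∑ n ∈ Finset.range (x + 1), ((∑ i, #((Nat.primesLE z ∪ ((Nat.primesLE z).filter (fun p => p ^ 2 ≤ z)).image (fun p => p ^ 2)).filter
      (fun q => q ∣ ((f i).eval (n : ℤ)).toNat ∧ ((f i).eval (n : ℤ)).toNat ≠ 0)) : ℕ) : ℝ) *
        ((∑ i, Real.log (((f i).eval (n : ℤ)).toNat : ℝ)) / Real.log x)) = ∑ n ∈ range (x + 1), a n * g n :=
    sum_congr rfl fun n _ => by rw [haf n, hgf n]
  have hc2 : (∑ n ∈ Finset.range (x + 1), ((∑ i, #((Nat.primesLE z ∪ ((Nat.primesLE z).filter (fun p => p ^ 2 ≤ z)).image (fun p => p ^ 2)).filter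
      (fun q => q ∣ ((f i).eval (n : ℤ)).toNat ∧ ((f i).eval (n : ℤ)).toNat ≠ 0)) : ℕ) : ℝ)) = ∑ n ∈ range (x + 1), a n :=
    sum_congr rfl fun n _ => haf n
  have hc3 : (∑ n ∈ Finset.range (x + 1), (∑ i, Real.log (((f i).eval (n : ℤ)).toNat : ℝ)) / Real.log x) =
      ∑ n ∈ range (x + 1), g n := sum_congr rfl fun n _ => hgf n
  rw [hc1, hc2, hc3]
  -- pointwise bounds on `a`
  have ha0 : ∀ n ∈ range (x + 1), 0 ≤ a n := fun n _ => by rw [← haf n]; exact Nat.cast_nonneg _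
  have haM : ∀ n ∈ range (x + 1), a n ≤ α + β * Real.log x := by
    intro n hn
    have hnx : n ≤ x := Nat.lt_succ_iff.1 (mem_range.1 hn)
    rw [ha]
    simp only [Nat.cast_sum]
    rw [hα, hβ, sum_mul, ← sum_add_distrib]
    refine sum_le_sum fun i _ => ?_
    have h1 := smallCount_le_log (f i) z hx1 hnx
    have h2 : 2 / Real.log 2 * (Real.log (((∑ j ∈ range ((f i).natDegree + 1), ((f i).coeff j).natAbs : ℕ) : ℝ) + 1) +
        ((f i).natDegree : ℝ) * (Real.log x + 1)) = 2 / Real.log 2 * (Hl i + d i) + 2 / Real.log 2 * d i * Real.log x := by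
      simp only [hHl, hd]; ring
    linarith
  -- termwise bound on `|log fᵢ(n)⁺ - dᵢ log x|`
  have hterm : ∀ i, ∀ n ∈ range (x + 1),
      |Real.log (((f i).eval (n : ℤ)).toNat : ℝ) - d i * Real.log x| ≤
        d i * (Real.log x - Real.log n) + B i + (if n < n₁ then 2 * d i * Real.log x else 0) := by
    intro i n hn
    have hnx : n ≤ x := Nat.lt_succ_iff.1 (mem_range.1 hn)
    set m : ℕ := ((f i).eval (n : ℤ)).toNat with hm
    have hlogn : Real.log n ≤ Real.log x := by
      rcases Nat.eq_zero_or_pos n with rfl | hnpos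
      · simp only [Nat.cast_zero, Real.log_zero]; linarith
      · exact Real.log_le_log (by exact_mod_cast hnpos) (by exact_mod_cast hnx)
    have hlogm0 : 0 ≤ Real.log (m : ℝ) := Real.log_natCast_nonneg m
    -- upper bound `log m ≤ Hl i + d i * (log x + 1)`
    have hup : Real.log (m : ℝ) ≤ Hl i + d i * (Real.log x + 1) := by
      have hmle : m ≤ (∑ j ∈ range ((f i).natDegree + 1), ((f i).coeff j).natAbs) * (x + 1) ^ (f i).natDegree :=
        toNat_eval_le (f i) hnx
      rcases Nat.eq_zero_or_pos m with h0 | hmpos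
      · rw [h0, Nat.cast_zero, Real.log_zero]
        have := hHl0 i; have := hd0 i; positivity
      · have hx1R : (1 : ℝ) ≤ x := by linarith
        have hx1' : Real.log ((x : ℝ) + 1) ≤ Real.log x + 1 := by
          have h4 : Real.log ((x : ℝ) + 1) - Real.log x ≤ 1 := by
            rw [← Real.log_div (by positivity) (by positivity)]
            have h5 := Real.log_le_sub_one_of_pos (show (0 : ℝ) < ((x : ℝ) + 1) / x by positivity)
            have h6 : ((x : ℝ) + 1) / x - 1 = 1 / x := by field_simp; ring
            have h7 : (1 : ℝ) / x ≤ 1 := by rw [div_le_one (by positivity)]; exact hx1R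
            linarith
          linarith
        have h1 : (m : ℝ) ≤ (((∑ j ∈ range ((f i).natDegree + 1), ((f i).coeff j).natAbs : ℕ) : ℝ) + 1) * ((x : ℝ) + 1) ^ (f i).natDegree := by
          have h2 : (m : ℝ) ≤ ((∑ j ∈ range ((f i).natDegree + 1), ((f i).coeff j).natAbs : ℕ) : ℝ) * ((x : ℝ) + 1) ^ (f i).natDegree := by
            exact_mod_cast hmle
          nlinarith [pow_nonneg hY0.le (f i).natDegree]
        calc Real.log (m : ℝ) ≤ Real.log ((((∑ j ∈ range ((f i).natDegree + 1), ((f i).coeff j).natAbs : ℕ) : ℝ) + 1) * ((x : ℝ) + 1) ^ (f i).natDegree) :=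
              Real.log_le_log (by exact_mod_cast hmpos) h1
          _ = Hl i + d i * Real.log ((x : ℝ) + 1) := by
              rw [Real.log_mul (by positivity) (by positivity), Real.log_pow]
          _ ≤ Hl i + d i * (Real.log x + 1) := by gcongr
    rw [mul_add, mul_one] at hup
    have e1 : d i * (Real.log x - Real.log n) = d i * Real.log x - d i * Real.log n := by ring
    have p1 : 0 ≤ d i * Real.log x - d i * Real.log n := by
      rw [← e1]; exact mul_nonneg (hd0 i) (sub_nonneg.2 hlogn)
    have p2 : 0 ≤ d i * Real.log x := mul_nonneg (hd0 i) hlogx0.le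
    have hHi := hHl0 i
    have hdi := hd0 i
    by_cases hlt : n < n₁
    · rw [if_pos hlt, abs_le, e1]
      simp only [hB]
      constructor
      · linarith
      · linarith
    · rw [if_neg hlt, add_zero, e1]
      have hnn : n₁ ≤ n := not_lt.1 hlt
      have hn1 : 1 ≤ n := le_trans (Nat.le_add_left 1 _) hnn
      have hnR : (1 : ℝ) ≤ n := by exact_mod_cast hn1
      -- lower bound `d i * log n ≤ log 2 + log m`
      have hlow := hn0 i n (hn₁i i n hnn)
      have hnd : (1 : ℝ) ≤ (n : ℝ) ^ (f i).natDegree := one_le_pow₀ hnR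
      have hmpos : (0 : ℝ) < ((((f i).eval (n : ℤ)) : ℤ) : ℝ) := by linarith
      have hmeq : (m : ℝ) = ((((f i).eval (n : ℤ)) : ℤ) : ℝ) := by
        have h0 : (0 : ℤ) ≤ (f i).eval (n : ℤ) := by exact_mod_cast hmpos.le
        rw [hm]
        exact_mod_cast Int.toNat_of_nonneg h0
      have hlow' : d i * Real.log n ≤ Real.log 2 + Real.log (m : ℝ) := by
        rw [hmeq, ← Real.log_pow, ← Real.log_mul (by norm_num) hmpos.ne']
        exact Real.log_le_log (by positivity) hlow
      have hlog2' : Real.log 2 ≤ 1 := by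
        have := Real.log_le_sub_one_of_pos (by norm_num : (0 : ℝ) < 2); linarith
      rw [abs_le]
      simp only [hB]
      constructor
      · linarith
      · linarith
  -- `Σ_n |g n - cG| ≤ CG (x + 1) / log x`
  have hsumG : ∑ n ∈ range (x + 1), |g n - cG| ≤ CG * ((x : ℝ) + 1) / Real.log x := by
    have hgn : ∀ n, g n - cG = (∑ i, (Real.log (((f i).eval (n : ℤ)).toNat : ℝ) - d i * Real.log x)) / Real.log x := by
      intro n
      rw [hg, hcG]
      simp only
      rw [sum_sub_distrib, sub_div, ← sum_mul, mul_div_assoc, div_self hlogx0.ne', mul_one]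
    have h1 : ∀ n ∈ range (x + 1), |g n - cG| ≤
        (∑ i, (d i * (Real.log x - Real.log n) + B i + (if n < n₁ then 2 * d i * Real.log x else 0))) / Real.log x := by
      intro n hn
      rw [hgn n, abs_div, abs_of_pos hlogx0]
      refine div_le_div_of_nonneg_right ((abs_sum_le_sum_abs _ _).trans (sum_le_sum fun i _ => hterm i n hn)) hlogx0.le
    refine (sum_le_sum h1).trans ?_
    rw [← sum_div, div_le_div_iff_of_pos_right hlogx0, sum_comm]
    have h2 : ∀ i, ∑ n ∈ range (x + 1), (d i * (Real.log x - Real.log n) + B i + (if n < n₁ then 2 * d i * Real.log x else 0)) ≤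
        (2 * d i + B i + 2 * d i * n₁) * ((x : ℝ) + 1) := by
      intro i
      rw [sum_add_distrib, sum_add_distrib, sum_const, card_range, nsmul_eq_mul, ← mul_sum, sum_ite, sum_const_zero,
        add_zero, sum_const, nsmul_eq_mul]
      have h3 := sum_log_sub_log_le x
      have h4 : (#((range (x + 1)).filter (fun n => n < n₁)) : ℝ) ≤ n₁ := by
        have : (range (x + 1)).filter (fun n => n < n₁) ⊆ range n₁ := fun n hn => by
          rw [mem_filter] at hn; exact mem_range.2 hn.2
        exact_mod_cast (card_le_card this).trans (card_range n₁).le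
      have h5 : (#((range (x + 1)).filter (fun n => n < n₁)) : ℝ) * (2 * d i * Real.log x) ≤ n₁ * (2 * d i * ((x : ℝ) + 1)) :=
        mul_le_mul h4 (by nlinarith [hd0 i]) (by positivity) (by positivity)
      have h6 : d i * ∑ n ∈ range (x + 1), (Real.log x - Real.log n) ≤ d i * (2 * x) := mul_le_mul_of_nonneg_left h3 (hd0 i)
      push_cast
      nlinarith [hd0 i, hB0 i]
    calc ∑ i, ∑ n ∈ range (x + 1), (d i * (Real.log x - Real.log n) + B i + (if n < n₁ then 2 * d i * Real.log x else 0))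
        ≤ ∑ i, (2 * d i + B i + 2 * d i * n₁) * ((x : ℝ) + 1) := sum_le_sum fun i _ => h2 i
      _ = CG * ((x : ℝ) + 1) := by rw [hCG, sum_mul]
  /- ### conclusion -/
  have hcov := abs_cov_le_two_mul_sup_mul_mean_abs x a g (α + β * Real.log x) cG ha0 haM
  refine hcov.trans ?_
  have h1 : (∑ n ∈ range (x + 1), |g n - cG|) / ((x : ℝ) + 1) ≤ CG / Real.log x := by
    rw [div_le_iff₀ hY0]
    calc _ ≤ CG * ((x : ℝ) + 1) / Real.log x := hsumG
      _ = CG / Real.log x * ((x : ℝ) + 1) := by ring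
  have h2 : α + β * Real.log x ≤ (α + β) * Real.log x := by nlinarith
  have h3 : 0 ≤ α + β * Real.log x := by positivity
  calc 2 * (α + β * Real.log x) * ((∑ n ∈ range (x + 1), |g n - cG|) / ((x : ℝ) + 1))
      ≤ 2 * ((α + β) * Real.log x) * (CG / Real.log x) :=
        mul_le_mul (by linarith) h1 (by positivity) (by positivity)
    _ = 2 * (α + β) * CG := by field_simp

/-! ### The rough von Mangoldt mass and the main theorem -/

/-- **Chebyshev–Hooley splitting.**  The von Mangoldt mass of the divisors of `m` outside `PP(z)` is
`log m` minus the small mass: `Σ_{d ∣ m, d ∉ PP(z)} Λ(d) = log m − Σ_{q ∈ PP(z), q ∣ m ≠ 0} Λ(q)`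
(`Σ_{d ∣ m} Λ(d) = log m`; both sides vanish for `m = 0`). [folklore] -/
theorem roughMass_eq (z m : ℕ) :
    ∑ d ∈ m.divisors.filter (fun d => d ∉ (Nat.primesLE z ∪ ((Nat.primesLE z).filter (fun p => p ^ 2 ≤ z)).image (fun p => p ^ 2))),
        ArithmeticFunction.vonMangoldt d =
      Real.log m - ∑ q ∈ (Nat.primesLE z ∪ ((Nat.primesLE z).filter (fun p => p ^ 2 ≤ z)).image (fun p => p ^ 2)).filter
        (fun q => q ∣ m ∧ m ≠ 0), ArithmeticFunction.vonMangoldt q := by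
  rcases eq_or_ne m 0 with rfl | hm
  · simp
  · have htot := ArithmeticFunction.vonMangoldt_sum (n := m)
    rw [← sum_filter_add_sum_filter_not m.divisors
      (fun d => d ∈ (Nat.primesLE z ∪ ((Nat.primesLE z).filter (fun p => p ^ 2 ≤ z)).image (fun p => p ^ 2)))] at htot
    have hsame : ∑ d ∈ m.divisors.filter (fun d => d ∈ (Nat.primesLE z ∪ ((Nat.primesLE z).filter (fun p => p ^ 2 ≤ z)).image (fun p => p ^ 2))),
        ArithmeticFunction.vonMangoldt d =
        ∑ q ∈ (Nat.primesLE z ∪ ((Nat.primesLE z).filter (fun p => p ^ 2 ≤ z)).image (fun p => p ^ 2)).filter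
          (fun q => q ∣ m ∧ m ≠ 0), ArithmeticFunction.vonMangoldt q := by
      refine sum_congr ?_ fun _ _ => rfl
      ext d
      simp only [mem_filter, Nat.mem_divisors]
      tauto
    rw [hsame] at htot
    linarith

/-- Linearity of the empirical covariance in the second variable. [folklore] -/
theorem cov_sub (x : ℕ) (a g r : ℕ → ℝ) (Y : ℝ) :
    (∑ n ∈ range (x + 1), a n * (g n - r n)) / Y - (∑ n ∈ range (x + 1), a n) / Y * ((∑ n ∈ range (x + 1), (g n - r n)) / Y) =
      ((∑ n ∈ range (x + 1), a n * g n) / Y - (∑ n ∈ range (x + 1), a n) / Y * ((∑ n ∈ range (x + 1), g n) / Y)) -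
        ((∑ n ∈ range (x + 1), a n * r n) / Y - (∑ n ∈ range (x + 1), a n) / Y * ((∑ n ∈ range (x + 1), r n) / Y)) := by
  rw [sum_sub_distrib, sum_congr rfl fun n _ => mul_sub (a n) (g n) (r n), sum_sub_distrib]
  ring

/-- **The MASS companion of the crux is a theorem.**  For every Bateman–Horn system `f` there is `C`
such that for all `x ≥ 2`: `|Cov_x(A, M)| ≤ C`, where `A(n) = Σᵢ #{q ∈ PP(⌊√x⌋) : q ∣ fᵢ(n)⁺ ≠ 0}`
is the small count of the two-sided localisation and
`M(n) = (Σᵢ Σ_{d ∣ fᵢ(n)⁺, d ∉ PP(⌊√x⌋)} Λ(d)) / log x` is the ROUGH VON MANGOLDT MASS of the values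
(the log-mass, in units of `log x`, of the prime-power divisors beyond `PP(√x)`: every prime `p > √x`
of `fᵢ(n)` with its full multiplicity — so `M ≥ B′/2` on the primes `> √x` counted by the capped rough
count `B` of the crux — plus the excess powers of the primes `≤ √x`; `0 ≤ M ≤ Σᵢ dᵢ + o(1)`).
By `Localisation.systemMomentDeficit_iff_covLowerBound` the crux `SystemMomentDeficit` is, system by
system, the ONE-sided bound `Cov_x(A, B) ≥ −C` for the rough COUNT `B`; replacing the count of the
large prime factors by their MASS makes the statement two-sided and unconditional, because
Chebyshev–Hooley (`Σ_{d ∣ N} Λ(d) = log N`, `roughMass_eq`) turns `M` into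
`Σᵢ log fᵢ(n)⁺/log x − (small mass)`, a level-`√x` object (`abs_cov_smallCount_smallMass_le_core`,
`abs_cov_smallCount_logSize_le`).  Hence all the open content of the crux (for `Σ deg ≥ 2`) is the
conversion mass → count of the prime factors beyond `√x`, i.e. the law of their sizes jointly with the
small primes of the values (crux dossier `Cruxes/SystemMomentDeficit/NOTES.md`, lead c5). [folklore] -/
theorem abs_cov_smallCount_roughMass_le :
    ∀ (k : ℕ) (f : Fin k → ℤ[X]), IsBatemanHornSystem f →
    ∃ C : ℝ, ∀ x : ℕ, 2 ≤ x →
      |(∑ n ∈ Finset.range (x + 1),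
          ((∑ i, #((Nat.primesLE (Nat.sqrt x) ∪ ((Nat.primesLE (Nat.sqrt x)).filter (fun p => p ^ 2 ≤ Nat.sqrt x)).image (fun p => p ^ 2)).filter (fun q => q ∣ ((f i).eval (n : ℤ)).toNat ∧ ((f i).eval (n : ℤ)).toNat ≠ 0)) : ℕ) : ℝ) *
            ((∑ i, ∑ d ∈ (((f i).eval (n : ℤ)).toNat.divisors).filter (fun d => d ∉ (Nat.primesLE (Nat.sqrt x) ∪ ((Nat.primesLE (Nat.sqrt x)).filter (fun p => p ^ 2 ≤ Nat.sqrt x)).image (fun p => p ^ 2))), ArithmeticFunction.vonMangoldt d) / Real.log x)) / ((x : ℝ) + 1) -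
        (∑ n ∈ Finset.range (x + 1),
          ((∑ i, #((Nat.primesLE (Nat.sqrt x) ∪ ((Nat.primesLE (Nat.sqrt x)).filter (fun p => p ^ 2 ≤ Nat.sqrt x)).image (fun p => p ^ 2)).filter (fun q => q ∣ ((f i).eval (n : ℤ)).toNat ∧ ((f i).eval (n : ℤ)).toNat ≠ 0)) : ℕ) : ℝ)) / ((x : ℝ) + 1) *
          ((∑ n ∈ Finset.range (x + 1),
            (∑ i, ∑ d ∈ (((f i).eval (n : ℤ)).toNat.divisors).filter (fun d => d ∉ (Nat.primesLE (Nat.sqrt x) ∪ ((Nat.primesLE (Nat.sqrt x)).filter (fun p => p ^ 2 ≤ Nat.sqrt x)).image (fun p => p ^ 2))), ArithmeticFunction.vonMangoldt d) / Real.log x) / ((x : ℝ) + 1))| ≤ C := by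
  intro k f hf
  obtain ⟨CR, hCR⟩ := abs_cov_smallCount_smallMass_le_core k f hf
  obtain ⟨CG, hCG⟩ := abs_cov_smallCount_logSize_le k f hf
  -- the statement for `x ≥ 4`
  have h4 : ∀ x : ℕ, 4 ≤ x →
      |(∑ n ∈ Finset.range (x + 1),
          ((∑ i, #((Nat.primesLE (Nat.sqrt x) ∪ ((Nat.primesLE (Nat.sqrt x)).filter (fun p => p ^ 2 ≤ Nat.sqrt x)).image (fun p => p ^ 2)).filter (fun q => q ∣ ((f i).eval (n : ℤ)).toNat ∧ ((f i).eval (n : ℤ)).toNat ≠ 0)) : ℕ) : ℝ) *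
            ((∑ i, ∑ d ∈ (((f i).eval (n : ℤ)).toNat.divisors).filter (fun d => d ∉ (Nat.primesLE (Nat.sqrt x) ∪ ((Nat.primesLE (Nat.sqrt x)).filter (fun p => p ^ 2 ≤ Nat.sqrt x)).image (fun p => p ^ 2))), ArithmeticFunction.vonMangoldt d) / Real.log x)) / ((x : ℝ) + 1) -
        (∑ n ∈ Finset.range (x + 1),
          ((∑ i, #((Nat.primesLE (Nat.sqrt x) ∪ ((Nat.primesLE (Nat.sqrt x)).filter (fun p => p ^ 2 ≤ Nat.sqrt x)).image (fun p => p ^ 2)).filter (fun q => q ∣ ((f i).eval (n : ℤ)).toNat ∧ ((f i).eval (n : ℤ)).toNat ≠ 0)) : ℕ) : ℝ)) / ((x : ℝ) + 1) *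
          ((∑ n ∈ Finset.range (x + 1),
            (∑ i, ∑ d ∈ (((f i).eval (n : ℤ)).toNat.divisors).filter (fun d => d ∉ (Nat.primesLE (Nat.sqrt x) ∪ ((Nat.primesLE (Nat.sqrt x)).filter (fun p => p ^ 2 ≤ Nat.sqrt x)).image (fun p => p ^ 2))), ArithmeticFunction.vonMangoldt d) / Real.log x) / ((x : ℝ) + 1))| ≤ CG + CR := by
    intro x hx
    have hM : ∀ n : ℕ, (∑ i, ∑ d ∈ (((f i).eval (n : ℤ)).toNat.divisors).filter (fun d => d ∉ (Nat.primesLE (Nat.sqrt x) ∪ ((Nat.primesLE (Nat.sqrt x)).filter (fun p => p ^ 2 ≤ Nat.sqrt x)).image (fun p => p ^ 2))), ArithmeticFunction.vonMangoldt d) / Real.log x =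
        (∑ i, Real.log (((f i).eval (n : ℤ)).toNat : ℝ)) / Real.log x -
          (∑ i, ∑ q ∈ (Nat.primesLE (Nat.sqrt x) ∪ ((Nat.primesLE (Nat.sqrt x)).filter (fun p => p ^ 2 ≤ Nat.sqrt x)).image (fun p => p ^ 2)).filter (fun q => q ∣ ((f i).eval (n : ℤ)).toNat ∧ ((f i).eval (n : ℤ)).toNat ≠ 0), ArithmeticFunction.vonMangoldt q) / Real.log x := by
      intro n
      rw [← sub_div, ← sum_sub_distrib]
      exact congrArg (· / Real.log x) (sum_congr rfl fun i _ => roughMass_eq (Nat.sqrt x) _)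
    simp only [hM]
    rw [cov_sub]
    have h1 := hCG x hx
    have h2 := hCR x hx
    exact (abs_sub _ _).trans (add_le_add h1 h2)
  -- absorb `x ∈ {2, 3}`
  set gfun : ℕ → ℝ := fun x : ℕ =>
      (∑ n ∈ Finset.range (x + 1),
          ((∑ i, #((Nat.primesLE (Nat.sqrt x) ∪ ((Nat.primesLE (Nat.sqrt x)).filter (fun p => p ^ 2 ≤ Nat.sqrt x)).image (fun p => p ^ 2)).filter (fun q => q ∣ ((f i).eval (n : ℤ)).toNat ∧ ((f i).eval (n : ℤ)).toNat ≠ 0)) : ℕ) : ℝ) *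
            ((∑ i, ∑ d ∈ (((f i).eval (n : ℤ)).toNat.divisors).filter (fun d => d ∉ (Nat.primesLE (Nat.sqrt x) ∪ ((Nat.primesLE (Nat.sqrt x)).filter (fun p => p ^ 2 ≤ Nat.sqrt x)).image (fun p => p ^ 2))), ArithmeticFunction.vonMangoldt d) / Real.log x)) / ((x : ℝ) + 1) -
        (∑ n ∈ Finset.range (x + 1),
          ((∑ i, #((Nat.primesLE (Nat.sqrt x) ∪ ((Nat.primesLE (Nat.sqrt x)).filter (fun p => p ^ 2 ≤ Nat.sqrt x)).image (fun p => p ^ 2)).filter (fun q => q ∣ ((f i).eval (n : ℤ)).toNat ∧ ((f i).eval (n : ℤ)).toNat ≠ 0)) : ℕ) : ℝ)) / ((x : ℝ) + 1) *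
          ((∑ n ∈ Finset.range (x + 1),
            (∑ i, ∑ d ∈ (((f i).eval (n : ℤ)).toNat.divisors).filter (fun d => d ∉ (Nat.primesLE (Nat.sqrt x) ∪ ((Nat.primesLE (Nat.sqrt x)).filter (fun p => p ^ 2 ≤ Nat.sqrt x)).image (fun p => p ^ 2))), ArithmeticFunction.vonMangoldt d) / Real.log x) / ((x : ℝ) + 1)) with hgfun
  have key := abs_le_max_mul_of_threshold gfun (fun _ => (1 : ℝ)) 4 (CG + CR) (fun _ => le_rfl)
    (fun x hx => by rw [mul_one, hgfun]; exact h4 x hx)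
  refine ⟨max (CG + CR) (∑ y ∈ range 4, |gfun y|), fun x _ => ?_⟩
  have := key x
  rw [mul_one, hgfun] at this
  exact this

end Summit.Parity.BatemanHorn.Cruxes.SystemMomentDeficit.MassCount
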